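import Mathlib

/-!
# Unipotent ρ-law — KERNEL SHADOW of the cell memo `U-DOOR-INPUT-unipotent1-g6.md`
(MINT block B2 «alphabet UNIPOTENT ∕ homogeneous letters», hsemireg-alphabet-unipotent-1 g6, 2026-08-29)

Crux of record: `Summit.HodgeConjecture.HodgeConjecture.Theses.EightfoldBlochSeeds.BlochSeedDiscOne`
(item stmt-HodgeConjecture-18881; skeleton `Lines/birth.lean` 814a6a70c14e831a, STUB R `stub_rung_pad4_seedAt` —
UNTOUCHED here).  Nothing in this file proves HC, HC_AV, HC_CM, H2, №4/26512 or item 18881, and nothing here is a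
statement about sheaves on `X = S⁴`: it types the finitary linear-algebra cores of the memo
`hsemireg-alphabet-unipotent-1/g6/memo/U-DOOR-INPUT-unipotent1-g6.md` (director R19.371 ORDER (2)(0): the typed door inputs
(α) class list, (β) RHO LAW, (α′) LEMMA CLONE for the typing U4 on 16·bd78f9c7), so that the multiplicities `ρ` the
Σ-H₃ door multiplies by are kernel facts and not pencil lines.  Mathlib only; no `sorry`; no instances, no notation.

THE RHO LAW (memo §2): on one factor `S = E²`, for U4 letters `U_X ⊗ L_x → U_Y ⊗ L_y` with `U ∈ {𝒪, At_c = π_c^* F₂}`,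
`h^j(Hom(U_X,U_Y) ⊗ L_y ⊗ L_x⁻¹) = ρ(T_X,T_Y,kind Δ) · h^j_LINE(L_y ⊗ L_x⁻¹)`, where the fibre module of `At_c` is
`(K², s = a_c N, t = −β_c N)` (`N` the 2 × 2 Jordan block) and `g_n = β_n s + a_n t` acts on it by the TWIST SCALAR
`κ = β_n a_c − a_n β_c` times `N`.  The multiplicities are dimensions of solution spaces of linear equations in
`Hom(T_X,T_Y)`; this file exhibits those solution spaces explicitly:

* Part A — the solution spaces.  `twistedAd_apply`/`twistedComm_iff`/`twistedComm_param`: for `c ≠ 0` the equation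
  `c·(N X) = d·(X N)` on 2 × 2 matrices reads `X₁₀ = 0 ∧ c X₁₁ = d X₀₀`, a 2-parameter family `!![c t, b; 0, d t]`
  (ρ_null(At,At) = 2 when `g_n ≠ 0` on both sides; with `c = d` it is the commutant, ρ_zero(At_c,At_c) = 2,
  `sameType_zeroStep_iff`); `leftAnn_iff`/`rightAnn_iff`: `c·(N X) = 0 ↔ X₁₀ = X₁₁ = 0`, `d·(X N) = 0 ↔ X₀₀ = X₁₀ = 0`
  (2 parameters: ρ_null = 2 when `g_n` vanishes on exactly one side); `col_ann_iff`/`row_ann_iff`: for a vector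
  `N v = 0 ↔ v₁ = 0`, for a covector `w N = 0 ↔ w₀ = 0` (1 parameter: ρ(O↔At_c) = 1 unless `g = 0`, where it is 2);
  `intertwine_both` + `zeroStep_distinct_iff`: two intertwining relations `a·(X N) = a'·(N X)`, `b·(X N) = b'·(N X)` with
  `a b' − a' b ≠ 0` force `X N = 0 = N X`, i.e. `X₀₀ = X₁₀ = X₁₁ = 0` (1 parameter: ρ_zero(At_c,At_c′) = 1 for `c ≠ c′`).
* Part B — [arith] the twist scalars of the design: for the four axis classes (`a = 1`, `β ∈ {1, i, −1, −i}`) and the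
  eight exotic null classes of bd78f9c7 (`a = 5`, `β ∈ {±3 ± 4i, ±4 ± 3i}`), `κ = β_n a_c − a_n β_c ≠ 0` whenever
  `n ≠ c` (Gaussian-integer `decide`), and the nullity `a² = N(β)`.
* Part C — the closed-form table `ρ` on the five U4 types as decidable functions (`rhoZero`, `rhoNull`, `rhoNondeg`)
  with its laws: symmetry (⇒ the direct rule for negative steps agrees with Serre duality), `1 ≤ ρ ≤ dim·dim`
  (⇒ LIVE^• and the BUDGET LAW), `ρ_zero ≤ ρ_null` — all by `decide`.
* Part D — LEMMA CLONE and the per-pair BUDGET LAW as finite-sum facts over ℕ: `clone_factor`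
  (`Σ_{i,j} n_i m_j ρ_ij · h = M_t · h`), `budget_upper` (`Σ n_i m_j ρ_ij ≤ (Σ n_i d_i)(Σ m_j e_j)` when `ρ_ij ≤ d_i e_j`),
  `budget_lower` (`(Σ n_i d_i)(Σ m_j e_j) ≤ 256 · Σ n_i m_j ρ_ij` when `d_i, e_j ≤ 16`, `1 ≤ ρ_ij`).
* Part E — [arith] digits of record: class counts, control sums, `U₂` as the sum of its nine Hom-blocks for LINE
  ac808a66 (c4-1's table) and for typed U4, typed `χ = 256 ×` LINE `χ`, `λ_min = 1∕128`.

Labels: [std] = standard linear algebra; [arith] = digits of record (design bd78f9c7be1aac4e ×16, typing U4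
c2464ca55e424b62, `g6/data/*` of the cell, c4-1 `ext2ub-table-g5.txt` b78576ea).  Census-neutral; no instrument run is
replaced by this file.
-/

set_option linter.dupNamespace false
set_option autoImplicit false

namespace Summit.HodgeConjecture.HodgeConjecture.Cruxes.BlochSeedDiscOne.UnipotentRhoLaw

open Matrix

/-! ## Part A — the solution spaces behind ρ -/
section PartA

variable {K : Type*} [Field K]

/-- The 2 × 2 Jordan block (`e₁` = socle, `e₂` = top): the common nilpotent of every `At_c`. -/
def jordanN : Matrix (Fin 2) (Fin 2) K := !![0, 1; 0, 0]

/-- [std] `N X = [[X₁₀, X₁₁],[0, 0]]`. -/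
theorem jordanN_mul (X : Matrix (Fin 2) (Fin 2) K) : jordanN * X = !![X 1 0, X 1 1; 0, 0] := by
  ext i j
  simp only [Matrix.mul_apply, Fin.sum_univ_two, jordanN]
  fin_cases i <;> fin_cases j <;> simp

/-- [std] `X N = [[0, X₀₀],[0, X₁₀]]`. -/
theorem mul_jordanN (X : Matrix (Fin 2) (Fin 2) K) : X * jordanN = !![0, X 0 0; 0, X 1 0] := by
  ext i j
  simp only [Matrix.mul_apply, Fin.sum_univ_two, jordanN]
  fin_cases i <;> fin_cases j <;> simp

/-- [std] The twisted ad: `c·(N X) − d·(X N) = [[c X₁₀, c X₁₁ − d X₀₀],[0, −d X₁₀]]` (`ad_{g_n}` on `Hom(At_c, At_c′)`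
with `c = κ(n,c′)`, `d = κ(n,c)`). -/
theorem twistedAd_apply (c d : K) (X : Matrix (Fin 2) (Fin 2) K) :
    c • (jordanN * X) - d • (X * jordanN) = !![c * X 1 0, c * X 1 1 - d * X 0 0; 0, -(d * X 1 0)] := by
  rw [jordanN_mul, mul_jordanN]
  ext i j
  fin_cases i <;> fin_cases j <;> simp

/-- [std] ρ_null(At,At), `g_n ≠ 0` on the target side: `c·(N X) = d·(X N)` iff `X₁₀ = 0 ∧ c X₁₁ = d X₀₀`. -/
theorem twistedComm_iff (c d : K) (hc : c ≠ 0) (X : Matrix (Fin 2) (Fin 2) K) :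
    c • (jordanN * X) = d • (X * jordanN) ↔ (X 1 0 = 0 ∧ c * X 1 1 = d * X 0 0) := by
  rw [← sub_eq_zero, twistedAd_apply]
  constructor
  · intro h
    have h00 : c * X 1 0 = 0 := by simpa using congr_fun (congr_fun h 0) 0
    have h01 : c * X 1 1 - d * X 0 0 = 0 := by simpa using congr_fun (congr_fun h 0) 1
    refine ⟨?_, sub_eq_zero.mp h01⟩
    rcases mul_eq_zero.mp h00 with h0 | h0
    · exact absurd h0 hc
    · exact h0
  · rintro ⟨h10, h⟩
    ext i j
    fin_cases i <;> fin_cases j <;> simp [h10, h]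

/-- [std] … explicitly a TWO-parameter family: `X = [[c t, b],[0, d t]]` (so ρ = 2; for `c = d` this is the Toeplitz
tie `t·1 + b·N`, for `d = 0` the left annihilator). -/
theorem twistedComm_param (c d : K) (hc : c ≠ 0) (X : Matrix (Fin 2) (Fin 2) K) :
    c • (jordanN * X) = d • (X * jordanN) ↔ ∃ t b : K, X = !![c * t, b; 0, d * t] := by
  rw [twistedComm_iff c d hc]
  constructor
  · rintro ⟨h10, h⟩
    refine ⟨X 0 0 / c, X 0 1, ?_⟩
    have h00 : X 0 0 = c * (X 0 0 / c) := by field_simp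
    have h11 : X 1 1 = d * (X 0 0 / c) := by
      field_simp
      linear_combination h
    ext i j
    fin_cases i <;> fin_cases j
    · simpa using h00
    · simp
    · simpa using h10
    · simpa using h11
  · rintro ⟨t, b, rfl⟩
    refine ⟨by simp, ?_⟩
    simp only [Matrix.of_apply, Matrix.cons_val', Matrix.cons_val_zero, Matrix.cons_val_one,
      Matrix.empty_val', Matrix.cons_val_fin_one]
    ring

/-- [std] ρ_zero(At_c, At_c) = 2: with equal non-zero twist on both sides the equation is the commutant,
`X₁₀ = 0 ∧ X₀₀ = X₁₁` (= `UnipotentDisplayLaw.comm_N_iff`). -/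
theorem sameType_zeroStep_iff (a : K) (ha : a ≠ 0) (X : Matrix (Fin 2) (Fin 2) K) :
    a • (jordanN * X) = a • (X * jordanN) ↔ (X 1 0 = 0 ∧ X 0 0 = X 1 1) := by
  rw [twistedComm_iff a a ha]
  constructor
  · rintro ⟨h10, h⟩
    exact ⟨h10, (mul_left_cancel₀ ha h).symm⟩
  · rintro ⟨h10, h⟩
    exact ⟨h10, by rw [h]⟩

/-- [std] ρ_null = 2 when `g_n` vanishes on the SOURCE only (`Hom(At_n, At_c)`, `c ≠ n`): `c·(N X) = 0 ↔ X₁₀ = X₁₁ = 0`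
(free: `X₀₀, X₀₁`). -/
theorem leftAnn_iff (c : K) (hc : c ≠ 0) (X : Matrix (Fin 2) (Fin 2) K) :
    c • (jordanN * X) = 0 ↔ (X 1 0 = 0 ∧ X 1 1 = 0) := by
  have h := twistedComm_iff c 0 hc X
  rw [zero_smul] at h
  rw [h]
  simp [hc]

/-- [std] ρ_null = 2 when `g_n` vanishes on the TARGET only (`Hom(At_c, At_n)`): `d·(X N) = 0 ↔ X₀₀ = X₁₀ = 0`
(free: `X₀₁, X₁₁`). -/
theorem rightAnn_iff (d : K) (hd : d ≠ 0) (X : Matrix (Fin 2) (Fin 2) K) :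
    d • (X * jordanN) = 0 ↔ (X 0 0 = 0 ∧ X 1 0 = 0) := by
  rw [mul_jordanN]
  constructor
  · intro h
    have h01 : d * X 0 0 = 0 := by simpa using congr_fun (congr_fun h 0) 1
    have h11 : d * X 1 0 = 0 := by simpa using congr_fun (congr_fun h 1) 1
    exact ⟨(mul_eq_zero.mp h01).resolve_left hd, (mul_eq_zero.mp h11).resolve_left hd⟩
  · rintro ⟨h00, h10⟩
    ext i j
    fin_cases i <;> fin_cases j <;> simp [h00, h10]

/-- [std] ρ(O → At_c) = 1 when `g ≠ 0` on `At_c` (and ρ_zero(O, At_c) = 1, the socle): a vector `v` with `c·(N v) = 0`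
has `v₁ = 0` (free: `v₀`). -/
theorem col_ann_iff (c : K) (hc : c ≠ 0) (v : Fin 2 → K) :
    c • (jordanN *ᵥ v) = 0 ↔ v 1 = 0 := by
  have hmv : jordanN *ᵥ v = ![v 1, 0] := by
    funext i
    fin_cases i <;> simp [jordanN, Matrix.mulVec, dotProduct, Fin.sum_univ_two]
  rw [hmv]
  constructor
  · intro h
    have h0 : c * v 1 = 0 := by simpa using congr_fun h 0
    exact (mul_eq_zero.mp h0).resolve_left hc
  · intro h1
    funext i
    fin_cases i <;> simp [h1]

/-- [std] ρ(At_c → O) = 1 when `g ≠ 0` on `At_c` (and ρ_zero(At_c, O) = 1, the top): a covector `w` with `d·(w N) = 0`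
has `w₀ = 0` (free: `w₁`). -/
theorem row_ann_iff (d : K) (hd : d ≠ 0) (w : Fin 2 → K) :
    d • (w ᵥ* jordanN) = 0 ↔ w 0 = 0 := by
  have hvm : w ᵥ* jordanN = ![0, w 0] := by
    funext j
    fin_cases j <;> simp [jordanN, Matrix.vecMul, dotProduct, Fin.sum_univ_two]
  rw [hvm]
  constructor
  · intro h
    have h1 : d * w 0 = 0 := by simpa using congr_fun h 1
    exact (mul_eq_zero.mp h1).resolve_left hd
  · intro h0
    funext j
    fin_cases j <;> simp [h0]

/-- [std] Cramer step: two relations `a·P = a'·Q`, `b·P = b'·Q` in a `K`-vector space with `a b' − a' b ≠ 0` force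
`P = 0` and `Q = 0`. -/
theorem intertwine_both {V : Type*} [AddCommGroup V] [Module K V] (a a' b b' : K) (P Q : V)
    (h1 : a • P = a' • Q) (h2 : b • P = b' • Q) (hdet : a * b' - a' * b ≠ 0) : P = 0 ∧ Q = 0 := by
  have hP : (a * b' - a' * b) • P = 0 := by
    calc (a * b' - a' * b) • P = b' • (a • P) - a' • (b • P) := by
            rw [sub_smul, smul_smul, smul_smul, mul_comm b' a]
      _ = b' • (a' • Q) - a' • (b' • Q) := by rw [h1, h2]
      _ = 0 := by rw [smul_smul, smul_smul, mul_comm b' a', sub_self]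
  have hP0 : P = 0 := (smul_eq_zero.mp hP).resolve_left hdet
  refine ⟨hP0, ?_⟩
  rw [hP0, smul_zero] at h1 h2
  by_contra hQ
  have ha' : a' = 0 := (smul_eq_zero.mp h1.symm).resolve_right hQ
  have hb' : b' = 0 := (smul_eq_zero.mp h2.symm).resolve_right hQ
  apply hdet
  rw [ha', hb']
  ring

/-- [std] `X N = 0 ∧ N X = 0 ↔ X₀₀ = X₁₀ = X₁₁ = 0` (free: `X₀₁` only). -/
theorem doubleAnn_iff (X : Matrix (Fin 2) (Fin 2) K) :
    (X * jordanN = 0 ∧ jordanN * X = 0) ↔ (X 0 0 = 0 ∧ X 1 0 = 0 ∧ X 1 1 = 0) := by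
  rw [mul_jordanN, jordanN_mul]
  constructor
  · rintro ⟨hR, hL⟩
    have h00 : X 0 0 = 0 := by simpa using congr_fun (congr_fun hR 0) 1
    have h10 : X 1 0 = 0 := by simpa using congr_fun (congr_fun hL 0) 0
    have h11 : X 1 1 = 0 := by simpa using congr_fun (congr_fun hL 0) 1
    exact ⟨h00, h10, h11⟩
  · rintro ⟨h00, h10, h11⟩
    constructor
    · ext i j
      fin_cases i <;> fin_cases j <;> simp [h00, h10]
    · ext i j
      fin_cases i <;> fin_cases j <;> simp [h10, h11]

/-- [std] ρ_zero(At_c, At_c′) = 1 for `c ≠ c′`: a module map must intertwine BOTH `s` (`a N` resp. `a' N`) and `t`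
(`b N` resp. `b' N`); if the coefficient pairs are not proportional (`a b' − a' b ≠ 0`, i.e. `c ≠ c′` as null
directions) only the socle-to-top map `X₀₁` survives. -/
theorem zeroStep_distinct_iff (a a' b b' : K) (hdet : a * b' - a' * b ≠ 0) (X : Matrix (Fin 2) (Fin 2) K) :
    (a • (X * jordanN) = a' • (jordanN * X) ∧ b • (X * jordanN) = b' • (jordanN * X)) ↔
      (X 0 0 = 0 ∧ X 1 0 = 0 ∧ X 1 1 = 0) := by
  rw [← doubleAnn_iff]
  constructor
  · rintro ⟨h1, h2⟩
    exact intertwine_both a a' b b' _ _ h1 h2 hdet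
  · rintro ⟨hR, hL⟩
    rw [hR, hL, smul_zero, smul_zero, smul_zero, smul_zero]
    exact ⟨rfl, rfl⟩

end PartA

/-! ## Part B — [arith] the twist scalars `κ = β_n a_c − a_n β_c` of the design are non-zero for `n ≠ c` -/
section PartB

/-- The four axis null classes `l_1, l_i, l_-1, l_-i`: `a_c = 1`, `β_c = x + iy ∈ ℤ[i]`. -/
def axisBeta : List GaussianInt := [⟨1, 0⟩, ⟨0, 1⟩, ⟨-1, 0⟩, ⟨0, -1⟩]

/-- The eight exotic primitive null classes `(5, ±3, ±4), (5, ±4, ±3)` occurring between letters of bd78f9c7: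
`a_n = 5`, `β_n = x + iy`. -/
def exoticBeta : List GaussianInt := [⟨3, 4⟩, ⟨3, -4⟩, ⟨-3, 4⟩, ⟨-3, -4⟩, ⟨4, 3⟩, ⟨4, -3⟩, ⟨-4, 3⟩, ⟨-4, -3⟩]

/-- [arith] Nullity `a² = N(β)`: `1 = N(β_c)` on the axes, `25 = N(β_n)` on the exotic classes. -/
theorem null_norms :
    (∀ β ∈ axisBeta, Zsqrtd.norm β = 1) ∧ (∀ β ∈ exoticBeta, Zsqrtd.norm β = 25) := by
  decide

/-- [arith] Axis against axis, `n ≠ c`: `κ = β_n·1 − 1·β_c ≠ 0` (⇒ `g_n` acts on `At_c` by a rank-1 nilpotent; also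
the non-proportionality `a_c β_c′ − a_c′ β_c ≠ 0` used by `zeroStep_distinct_iff`). -/
theorem twist_axis_ne_zero :
    ∀ βn ∈ axisBeta, ∀ βc ∈ axisBeta, βn ≠ βc → βn * 1 - 1 * βc ≠ 0 := by
  decide

/-- [arith] Exotic against axis: `κ = β_n·1 − 5·β_c ≠ 0` for all 8 × 4 pairs (⇒ ρ_null(exotic n) has O-rows 1 and
At–At entries 2, the `twistedComm`/`col_ann`/`row_ann` cases). -/
theorem twist_exotic_ne_zero :
    ∀ βn ∈ exoticBeta, ∀ βc ∈ axisBeta, βn * 1 - 5 * βc ≠ 0 := by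
  decide

end PartB

/-! ## Part C — the closed-form ρ table on the five U4 types and its laws -/
section PartC

/-- The U4 fibre types: `O` (trivial module `K`) and `At c`, `c : Fin 4` indexing `l_1, l_i, l_-1, l_-i`. -/
inductive UTy : Type
  | O : UTy
  | At : Fin 4 → UTy
  deriving DecidableEq, Fintype

/-- Fibre dimension: `dim O = 1`, `dim At_c = 2`. -/
def dimT : UTy → ℕ
  | .O => 1
  | .At _ => 2

/-- ρ_zero = `dim Hom_{R_S}(T_X, T_Y)`: 2 on `At_c → At_c` (Toeplitz tie), 1 otherwise. -/
def rhoZero : UTy → UTy → ℕ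
  | .At c, .At c' => if c = c' then 2 else 1
  | _, _ => 1

/-- ρ_null(n) = `dim ker ad_{g_n}` on `Hom(T_X,T_Y)`; `n = some c` an axis class, `n = none` an exotic class
(`g_n ≠ 0` on every `At_c`). -/
def rhoNull (n : Option (Fin 4)) : UTy → UTy → ℕ
  | .O, .O => 1
  | .O, .At c => if n = some c then 2 else 1
  | .At c, .O => if n = some c then 2 else 1
  | .At c, .At c' => if n = some c ∧ c = c' then 4 else 2

/-- ρ_nondeg = `dim T_X · dim T_Y` (ample, anti-ample and indefinite steps alike). -/
def rhoNondeg (X Y : UTy) : ℕ := dimT X * dimT Y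

/-- [std] SYMMETRY `ρ(X,Y,·) = ρ(Y,X,·)` — whence the direct rule for negative steps (anti-ample `(0,0,s)`,
`−k·n ↦ ρ·(0,k,k)`) agrees with Serre duality `h^j(W ⊗ M⁻¹) = h^{2−j}(W^∨ ⊗ M)` (`K_S = 𝒪`, `W^∨ = Hom(U_Y,U_X)`). -/
theorem rho_symm :
    (∀ X Y : UTy, rhoZero X Y = rhoZero Y X) ∧ (∀ X Y : UTy, rhoNondeg X Y = rhoNondeg Y X) ∧
    (∀ (n : Option (Fin 4)) (X Y : UTy), rhoNull n X Y = rhoNull n Y X) := by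
  refine ⟨by decide, by decide, by decide⟩

/-- [std] BOUNDS `1 ≤ ρ ≤ dim T_X · dim T_Y` for every kind — the lower bound is THEOREM LIVE^• (typing never kills a
LINE-live step), the upper bound is the per-factor BUDGET LAW (typed block ≤ rank × LINE block). -/
theorem rho_bounds :
    (∀ X Y : UTy, 1 ≤ rhoZero X Y ∧ rhoZero X Y ≤ rhoNondeg X Y) ∧
    (∀ (n : Option (Fin 4)) (X Y : UTy), 1 ≤ rhoNull n X Y ∧ rhoNull n X Y ≤ rhoNondeg X Y) ∧
    (∀ X Y : UTy, 1 ≤ rhoNondeg X Y ∧ rhoNondeg X Y ≤ 4) := by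
  refine ⟨by decide, by decide, by decide⟩

/-- [std] Semicontinuity `ρ_zero ≤ ρ_null(n)` (the commutant of `(s,t)` lies in the kernel of every `ad_{g_n}`). -/
theorem rhoZero_le_rhoNull : ∀ (n : Option (Fin 4)) (X Y : UTy), rhoZero X Y ≤ rhoNull n X Y := by
  decide

/-- [arith] The table entries quoted in the memo (§0/§2): `At_c → At_c` zero 2, `At_c → At_c′` zero 1; null `l_c`:
`O ↔ At_c` 2, `At_c → At_c` 4, other At pairs 2, `O ↔ At_c′` 1; exotic: O-rows 1, At–At 2; nondeg 1, 2, 4. -/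
theorem rho_entries :
    rhoZero (.At 0) (.At 0) = 2 ∧ rhoZero (.At 0) (.At 1) = 1 ∧ rhoZero .O (.At 2) = 1 ∧ rhoZero .O .O = 1 ∧
    rhoNull (some 0) .O (.At 0) = 2 ∧ rhoNull (some 0) (.At 0) (.At 0) = 4 ∧ rhoNull (some 0) (.At 0) (.At 1) = 2 ∧
    rhoNull (some 0) (.At 1) (.At 2) = 2 ∧ rhoNull (some 0) (.At 3) (.At 3) = 2 ∧ rhoNull (some 0) .O (.At 1) = 1 ∧
    rhoNull none .O (.At 0) = 1 ∧ rhoNull none (.At 0) (.At 0) = 2 ∧ rhoNull none (.At 1) (.At 3) = 2 ∧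
    rhoNondeg .O .O = 1 ∧ rhoNondeg .O (.At 0) = 2 ∧ rhoNondeg (.At 1) (.At 2) = 4 := by
  decide

end PartC

/-! ## Part D — LEMMA CLONE and the per-pair BUDGET LAW as finite-sum facts -/
section PartD

variable {ι κ : Type*}

/-- [std] LEMMA CLONE (memo §3): because `ρ` does not depend on the cohomological index, the LINE Künneth factor `h`
of a cell pair comes out of the sum over the class pairs: `Σ_{i,j} n_i m_j ρ_ij · h = M_t(x,y) · h`. -/
theorem clone_factor (s : Finset ι) (t : Finset κ) (n : ι → ℕ) (m : κ → ℕ) (ρ : ι → κ → ℕ) (h : ℕ) :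
    ∑ i ∈ s, ∑ j ∈ t, n i * m j * ρ i j * h = (∑ i ∈ s, ∑ j ∈ t, n i * m j * ρ i j) * h := by
  rw [Finset.sum_mul]
  refine Finset.sum_congr rfl fun i _ => ?_
  rw [Finset.sum_mul]

/-- [std] BUDGET LAW, upper half: with strands `s_i = n_i d_i`, `t_j = m_j e_j` and `ρ_ij ≤ d_i e_j`,
`M_t = Σ n_i m_j ρ_ij ≤ (Σ s_i)(Σ t_j)` (= `256 m_x m_y` at scale 16). -/
theorem budget_upper (s : Finset ι) (t : Finset κ) (n d : ι → ℕ) (m e : κ → ℕ) (ρ : ι → κ → ℕ)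
    (hρ : ∀ i j, ρ i j ≤ d i * e j) :
    ∑ i ∈ s, ∑ j ∈ t, n i * m j * ρ i j ≤ (∑ i ∈ s, n i * d i) * (∑ j ∈ t, m j * e j) := by
  rw [Finset.sum_mul_sum]
  refine Finset.sum_le_sum fun i _ => Finset.sum_le_sum fun j _ => ?_
  calc n i * m j * ρ i j ≤ n i * m j * (d i * e j) := Nat.mul_le_mul_left _ (hρ i j)
    _ = n i * d i * (m j * e j) := by ring

/-- [std] BUDGET LAW, lower half: with `d_i, e_j ≤ 16` (⊠ of four rank-≤-2 types) and `1 ≤ ρ_ij`,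
`(Σ s_i)(Σ t_j) ≤ 256 · M_t`, i.e. `m_x m_y ≤ M_t(x,y)` at scale 16 (`λ ≥ 1∕256`). -/
theorem budget_lower (s : Finset ι) (t : Finset κ) (n d : ι → ℕ) (m e : κ → ℕ) (ρ : ι → κ → ℕ)
    (hd : ∀ i, d i ≤ 16) (he : ∀ j, e j ≤ 16) (hρ : ∀ i j, 1 ≤ ρ i j) :
    (∑ i ∈ s, n i * d i) * (∑ j ∈ t, m j * e j) ≤ 256 * ∑ i ∈ s, ∑ j ∈ t, n i * m j * ρ i j := by
  rw [Finset.sum_mul_sum, Finset.mul_sum]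
  refine Finset.sum_le_sum fun i _ => ?_
  rw [Finset.mul_sum]
  refine Finset.sum_le_sum fun j _ => ?_
  calc n i * d i * (m j * e j) ≤ n i * 16 * (m j * 16) :=
        Nat.mul_le_mul (Nat.mul_le_mul_left _ (hd i)) (Nat.mul_le_mul_left _ (he j))
    _ = 256 * (n i * m j) := by ring
    _ ≤ 256 * (n i * m j * ρ i j) := Nat.mul_le_mul_left _ (Nat.le_mul_of_pos_right _ (hρ i j))

end PartD

/-! ## Part E — [arith] digits of record -/
section PartE

/-- [arith] (α): 1 892 classes = 840 + 572 + 480; strand nodes 15 384 = 8 040 + 5 568 + 1 776; typed rank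
`Σ_N − Σ_A − Σ_C = 128 = 16 · 8` strands; hubquad copies `128 = 4 · 2 · 2⁴`; pure-⊠ classes 400 + 300 + 0. -/
theorem class_digits :
    840 + 572 + 480 = 1892 ∧ 8040 + 5568 + 1776 = 15384 ∧ 834367872 - 539580160 - 294787584 = 128 ∧
    128 = 16 * 8 ∧ 128 = 4 * 2 * 2 ^ 4 ∧ 400 + 300 + 0 = 700 := by
  norm_num

/-- [arith] (γ) regression: c4-1's LINE digits on ac808a66 — `U₂ = h²(End A) + h²(End N) + h²(End C) + h¹(Hom(A,N))
+ h¹(Hom(N,C)) + h³(Hom(N,A)) + h³(Hom(C,N)) + h⁰(Hom(A,C)) + h⁴(Hom(C,A)) = 83 545 200 123 520`. -/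
theorem U2_LINE_ac808a66 :
    2249880285744 + 13818051179920 + 3864101463552 + 268283650176 + 107626416720 + 19509508846656 +
      26447733788016 + 262976544 + 17279751516192 = 83545200123520 := by
  norm_num

/-- [arith] (γ) typed U4 on 16·bd78f9c7: the same nine blocks sum to `U₂ = 940 474 111 982 292 550 848`. -/
theorem U2_TYPED_U4 :
    1127726469124149568 + 28378841427021471040 + 514703332241274432 + 605533949806660544224 +
      221528979188788701216 + 2338323810297768096 + 3149532755532572640 + 77590098036405819264 +
      311957156220250368 = 940474111982292550848 := by
  norm_num

/-- [arith] (γ) LINE bd78f9c7 (scale 1): `U₂ = 4 329 036 514 405 853 360`; typed `χ(End) = 256 ×` LINE `χ`;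
`256 · U₂^LINE ≥ U₂^typed ≥ U₂^LINE` (budget law on the total) and the observed extreme `λ_min = 2∕256 = 1∕128`. -/
theorem bd78f9c7_digits :
    104686758189466464 + 241118938005132768 + 4147455027515712 + 2444157934564297232 + 935742320180211024 +
      220619539977051600 + 25277992516862448 + 347343354692756928 + 5942221252559184 = 4329036514405853360 ∧
    (1030577402675200 : ℤ) = 256 * 4025692979200 ∧
    4329036514405853360 ≤ 940474111982292550848 ∧ 940474111982292550848 ≤ 256 * 4329036514405853360 ∧
    (2 : ℚ) / 256 = 1 / 128 := by
  norm_num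

end PartE

end Summit.HodgeConjecture.HodgeConjecture.Cruxes.BlochSeedDiscOne.UnipotentRhoLaw
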